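import Summits.Ventures.HodgeKum4.Theorems.KummerFixedLocusGammaInvariantsDominated
import Summits.Ventures.HodgeKum4.Theorems.KummerFixedLocusMotivicBookkeepingSplit
import Summits.Ventures.HodgeKum4.Theorems.KummerFixedLocusKum4NonInvariantClassesAlgebraic
import HarnessLib

/-!
# H3 for `Kum⁴`-type, modulo L1, the geometric residual I1geo and REFEREED print (cell `hodge-kum4`, seat p2)

HONEST FRAMING.  Nothing here proves the Hodge conjecture for `Kum⁴`-type varieties outright.  This
file COMPOSES the cell's kernel theorems into one CONDITIONAL statement: the rung
`HC_Kum4Type ∧ HC_Kum4TypePowers` (Hodge conjecture for every smooth projective eightfold of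
`Kum⁴`-type and for all its powers) follows from
* the cell lemma L1 `LefschetzGenerationKum4` (seat p1; COMPUTED-CERT, open in the kernel),
* the geometric residual I1geo `Kum4FixedFourfoldMeetsTranslates` (`@[conjecture]`; cell-proved on
  paper, HOME/p2/I1-PROOF.md + I1GEO-TRANSPORT.md; not in print for `n = 4`),
* and ELEVEN named printed facts of the tree, all REFEREED and all taken as hypotheses (the theorem
  is conditional on each): O'Grady–Markman–Voisin (`J³`), Floccari–Fu (powers of disc-1 Weil
  fourfolds), Foster (`B(X)`, `n + 1 = 5` prime), André (guarded dual Lefschetz), Hirzebruch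
  (`G`-signature), Floccari (Kummer fixed fourfold), Voisin (HI/HR middle), Göttsche–Soergel (`χ_y`),
  Green–Kim–Laza–Robles (LLV-trivial classes are Hodge), Foster (translation action) with Floccari
  (`|Γ| = 625`), Fulton (transversal point).
Route: L2a′ (`gammaInvariantsDominatedKum4_of_facts`) + F_Γ/F_Γ′ (`kum4TranslationGroup_of_literature`,
`…TrivialOffMiddle_of_literature`) + L3° (`kum4NonInvariantClassesAlgebraic_of_L1_of_meetsTranslates`)
fed into the record-free domination road `hc_kum4Type_of_dominated'` (Arapura Lem. 4.2 discharged in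
`CorCM.Stage4`, `AlgebraicClassesDominated` proved in `KummerFixedLocusMotivicBookkeepingSplit`).
-/

noncomputable section

open Literature.AlgebraicGeometry Literature.AlgebraicGeometry.HodgeTheory
open Literature.AlgebraicGeometry.Hyperkaehler

namespace Summit.Ventures.HodgeKum4

/-- **H3 modulo L1, I1geo and print**: the Hodge conjecture for every smooth projective `Kum⁴`-type
eightfold and all its powers, from the eleven REFEREED named facts (hypotheses), the cell lemma L1
and the geometric residual I1geo. -/
theorem hc_kum4Type_of_L1_of_meetsTranslates
    (hOGV : OGradyVoisin2022_thirdJacobian_kugaSatake_kummerType)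
    (hFF : FloccariFu2026_hodgeClasses_algebraic_powers_discOneWeilFourfold)
    (hFo : Foster2024_lefschetzStandard_kummerType_prime)
    (hAn : Andre1996_dualLefschetz_mem_adjoin_lefschetzInvolution)
    (hA1 : Hirzebruch1969_gSignature_involution_halfDimFixedLocus)
    (hA2 : Floccari2026_fixedFourfold_kum4Type)
    (hHIR : Voisin2002_hodgeIndex_hodgeRiemann_middle)
    (hGS : GoettscheSoergel1993_chiY_kum4Type)
    (hGK : GreenKimLazaRobles2022_llvTrivial_isOfHodgeType_kumType)
    (hF : Foster2024_translationAction_kum4Type)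
    (hcardF : Floccari2026_card_autFixingH2H3_kum4Type)
    (hFu : Fulton1998_cupPairing_transversalPoint)
    (hL1 : LefschetzGenerationKum4) (hgeo : Kum4FixedFourfoldMeetsTranslates) :
    Summit.Ventures.HodgeKum4.HC_Kum4Type ∧ Summit.Ventures.HodgeKum4.HC_Kum4TypePowers :=
  hc_kum4Type_of_dominated' hL1 (gammaInvariantsDominatedKum4_of_facts hOGV hFF hFo hAn)
    (kum4TranslationGroup_of_literature hcardF hF) (kum4TranslationGroupTrivialOffMiddle_of_literature hF)
    (kum4NonInvariantClassesAlgebraic_of_L1_of_meetsTranslates hA1 hA2 hHIR hGS hGK hF hcardF hFu hAn hL1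
      hgeo)

/-- **L2 `MotivicBookkeepingKum4` from four printed facts and the route nodes F_Γ, F_Γ′, L3°** (the
helper chain `motivicBookkeepingKum4_of_dominated_of_fixedLocus ∘ gammaInvariantsDominatedKum4_of_facts`
named by the director, D-0071 (1)): no L2a/L2c item is needed. -/
theorem motivicBookkeepingKum4_of_facts_of_fixedLocus
    (hOGV : OGradyVoisin2022_thirdJacobian_kugaSatake_kummerType)
    (hFF : FloccariFu2026_hodgeClasses_algebraic_powers_discOneWeilFourfold)
    (hFo : Foster2024_lefschetzStandard_kummerType_prime)
    (hAn : Andre1996_dualLefschetz_mem_adjoin_lefschetzInvolution)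
    (hΓ : Kum4TranslationGroup) (hoff : Kum4TranslationGroupTrivialOffMiddle)
    (h₃ : Kum4NonInvariantClassesAlgebraic) :
    Summit.Ventures.HodgeKum4.MotivicBookkeepingKum4 :=
  motivicBookkeepingKum4_of_dominated_of_fixedLocus (gammaInvariantsDominatedKum4_of_facts hOGV hFF hFo hAn)
    hΓ hoff h₃

/-- **H3 from four printed facts and the route nodes L1, F_Γ, F_Γ′, L3°** (item-level shape of the
domination road: the official assembly's L2 replaced by print). -/
theorem hc_kum4Type_of_facts_of_nodes
    (hOGV : OGradyVoisin2022_thirdJacobian_kugaSatake_kummerType)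
    (hFF : FloccariFu2026_hodgeClasses_algebraic_powers_discOneWeilFourfold)
    (hFo : Foster2024_lefschetzStandard_kummerType_prime)
    (hAn : Andre1996_dualLefschetz_mem_adjoin_lefschetzInvolution)
    (h₁ : LefschetzGenerationKum4) (hΓ : Kum4TranslationGroup) (hoff : Kum4TranslationGroupTrivialOffMiddle)
    (h₃ : Kum4NonInvariantClassesAlgebraic) :
    Summit.Ventures.HodgeKum4.HC_Kum4Type ∧ Summit.Ventures.HodgeKum4.HC_Kum4TypePowers :=
  hc_kum4Type_of_dominated' h₁ (gammaInvariantsDominatedKum4_of_facts hOGV hFF hFo hAn) hΓ hoff h₃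

end Summit.Ventures.HodgeKum4

end
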